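import Summits.PneNP.PneNP.Theorems.LatticeMagicTargetStubBridgeInstance
import Literature.Computability.Complexity.CodeFP
import Literature.Computability.Complexity.CodeFPArith
import Literature.Computability.Complexity.NegCNFTranscoder

/-!
# `stub_bridge`, part 3/6: blocks and disjuncts are polynomial time on codes

Line `SketchIdeator5` of crux `Target` (stmt-PneNP-10709), stub `stub_bridge` (Krajíček,
arXiv:2506.20221 §2). The code-level half of the generator of the proof system `V`, written in the
tree's typed algebra of `FP` maps `CodeFP` (`CodeFP.lean`): string bricks as typed maps (length,
bit access, head bit, drop, cons, the stretch-once brick `stretchOnceF` and `stretch`), the codes of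
formulas (`encE`: conjunction/disjunction on codes, `negCNFCode` for `¬ ofCNF`, the tagging of
literals `codeFP_tagLit` and of CNFs `codeFP_relab` — relabelling into the block of a tag is the map
`bin y ↦ v ++ bin (y+1)` on numerals), **`codeFP_block`** and **`codeFP_disjunct`** (a fold over the
images consuming the bits of the vector, with the polynomial bound on the accumulated code).

## References

* J. Krajíček, *A proof complexity conjecture and the Incompleteness theorem*, arXiv:2506.20221, §2
  (`DD_P`, Hypothesis (ST)); J. Krajíček, LMCS 16 (3:9) 2020.
* S. Arora, B. Barak, *Computational Complexity: A Modern Approach*, CUP 2009, §0.1 (codes), §1.3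
  (closure of polynomial time), §2.3 (CNFs, Cook–Levin), Example 2.21.
* S. A. Cook, R. A. Reckhow, JSL 44 (1979), §1 (proof systems).
-/

set_option linter.dupNamespace false -- summit = sub-problem (D-0017)

namespace Summit.PneNP.PneNP.Theorems.LatticeMagicTarget

open Literature.Computability.Complexity
open Literature.Computability.MetaComplexity
open _root_.Computability

namespace StubBridge

section Code

open CodeFP Brick Plumb Polynomial

/-- CNFs by the tree's `encodingCNF`. -/
abbrev cnfE : CNF ℕ → List Bool := encodingCNF.encode

/-- Formulas by the tree's `encodingPropForm`. -/
abbrev encE : PropForm ℕ → List Bool := encodingPropForm.encode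

/-- Literals: binary variable, polarity bit. -/
abbrev litE : Literal ℕ → List Bool := pairE natE bitE

/-- Parameters `(N, w⃗, m)`: `⟨N, ⟨encList w⃗, 1ᵐ⟩⟩`. -/
abbrev paramE : Param → List Bool := pairE strE (pairE (rawE strE) unE)

/-! #### String bricks as typed maps -/

/-- Dropping the first symbol. -/
theorem codeFP_drop_one : CodeFP strE strE (List.drop 1) :=
  ⟨dropFn ∘ fanoutFn (fun _ => [true]) id,
    comp_mem_FP dropFn_mem_FP (fanoutFn_mem_FP (const_mem_FP _) (PolyTimeComputable.id _)), fun s => by simp⟩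

/-- Bit `i` (unary) of a string (junk `false`), read as "`(s ⇂ i) ↾ 1 = [1]`". -/
theorem codeFP_getBit : CodeFP (pairE unE strE) bitE fun p => p.2.getD p.1 false :=
  ⟨eqPairFn ∘ fanoutFn (takeFn ∘ fanoutFn (fun _ => [true]) dropFn) (fun _ => [true]),
    comp_mem_FP eqPairFn_mem_FP (fanoutFn_mem_FP (comp_mem_FP takeFn_mem_FP
      (fanoutFn_mem_FP (const_mem_FP _) dropFn_mem_FP)) (const_mem_FP _)), fun p => by
    have h : decide (((p.2.drop p.1).take 1) = [true]) = p.2.getD p.1 false := by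
      rw [List.getD_eq_getElem?_getD, ← List.head?_drop]
      cases p.2.drop p.1 with
      | nil => simp
      | cons a m => cases a <;> simp
    simp only [pairE_apply, Function.comp_apply, fanoutFn_apply, dropFn_boolPair, length_unE,
      takeFn_boolPair, List.length_singleton, eqPairFn_boolPair, h, bitE, strE, id]⟩

/-- The head bit (junk `false`): bit `0`. -/
theorem codeFP_headD : CodeFP strE bitE fun s => s.headD false :=
  (codeFP_getBit.comp ((const strE 0).pair (CodeFP.id strE))).congr fun s => by
    cases s <;> rfl

/-- Prepending a fixed symbol. -/
theorem codeFP_cons (b : Bool) : CodeFP strE strE (List.cons b) := ⟨List.cons b, cons_mem_FP b, fun _ => rfl⟩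

/-- The stretch-once brick: `s ↦ dbl s` (`= ⟨s, ε⟩` truncated to `2|s|` symbols). -/
noncomputable def stretchOnceF : List Bool → List Bool :=
  takeFn ∘ fanoutFn (fun z => z ++ z) (fanoutFn id fun _ => [])

/-- `stretchOnceF ∈ FP`. -/
theorem stretchOnceF_mem_FP : stretchOnceF ∈ FP :=
  comp_mem_FP takeFn_mem_FP (fanoutFn_mem_FP (append_mem_FP (PolyTimeComputable.id _) (PolyTimeComputable.id _))
    (fanoutFn_mem_FP (PolyTimeComputable.id _) (const_mem_FP _)))

/-- `stretchOnceF` doubles every bit. -/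
theorem stretchOnceF_apply (s : List Bool) : stretchOnceF s = dbl s := by
  simp only [stretchOnceF, Function.comp_apply, fanoutFn_apply, id, takeFn_boolPair, List.length_append]
  rw [boolPair, List.append_assoc, List.take_append_of_le_length (by simp [List.length_flatMap]; omega),
    List.take_of_length_le (by simp [List.length_flatMap]; omega)]
  rfl

/-- Iterates of an `FP` function. -/
theorem iterate_mem_FP_const {f : List Bool → List Bool} (hf : f ∈ FP) : ∀ n : ℕ, f^[n] ∈ FP
  | 0 => PolyTimeComputable.id _
  | n + 1 => by rw [Function.iterate_succ]; exact comp_mem_FP (iterate_mem_FP_const hf n) hf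

/-- Iterating the stretch-once brick. -/
theorem stretchOnceF_iterate_apply : ∀ (t : ℕ) (s : List Bool), stretchOnceF^[t] s = dbl^[t] s
  | 0, s => by simp only [Function.iterate_zero, id]
  | t + 1, s => by
    rw [Function.iterate_succ_apply, Function.iterate_succ_apply, stretchOnceF_apply, stretchOnceF_iterate_apply t]

/-- Stretching by `2^t` (a constant) is polynomial time. -/
theorem codeFP_stretch (t : ℕ) : CodeFP strE strE (stretch t) :=
  ⟨stretchOnceF^[t], iterate_mem_FP_const stretchOnceF_mem_FP t, fun s => by
    show stretchOnceF^[t] s = stretch t s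
    rw [stretchOnceF_iterate_apply, dbl_iterate]⟩

/-! #### Formula codes -/

/-- The CNF code is the iterated list code of literal codes. -/
theorem cnfE_eq : (cnfE : CNF ℕ → List Bool) = listE (listE litE) := by
  change (encodingClause.listBool.encode : CNF ℕ → List Bool) = _
  rw [listE_eq, show (encodingClause.encode : Clause ℕ → List Bool) = listE litE from ?_]
  change (encodingLiteral.listBool.encode : Clause ℕ → List Bool) = _
  rw [listE_eq]
  rfl

/-- The formula code: unary size, then the prefix code. -/
theorem encE_apply (φ : PropForm ℕ) : encE φ = boolPair (unE φ.size) φ.code := rfl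

/-- Length of a formula code. -/
theorem length_encE (φ : PropForm ℕ) : (encE φ).length = 2 * φ.size + 2 + φ.code.length := by
  rw [encE_apply, length_boolPair, length_unE]

/-- A binary connective on codes: unary sizes add one, prefix codes concatenate behind a tag. -/
theorem codeFP_binop (tag : List Bool) (op : PropForm ℕ → PropForm ℕ → PropForm ℕ)
    (hsize : ∀ φ ψ, (op φ ψ).size = φ.size + ψ.size + 1) (hcode : ∀ φ ψ, (op φ ψ).code = tag ++ (φ.code ++ ψ.code)) :
    CodeFP (pairE encE encE) encE fun p => op p.1 p.2 := by
  refine ⟨fanoutFn (List.cons true ∘ fun z => fstF (fstF z) ++ fstF (sndF z))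
      ((fun z => tag ++ z) ∘ fun z => sndF (fstF z) ++ sndF (sndF z)),
    fanoutFn_mem_FP (comp_mem_FP (cons_mem_FP true) (append_mem_FP (comp_mem_FP fstF_mem_FP fstF_mem_FP)
      (comp_mem_FP fstF_mem_FP sndF_mem_FP)))
      (comp_mem_FP (append_mem_FP (const_mem_FP tag) (PolyTimeComputable.id _))
        (append_mem_FP (comp_mem_FP sndF_mem_FP fstF_mem_FP) (comp_mem_FP sndF_mem_FP sndF_mem_FP))), fun p => ?_⟩
  obtain ⟨φ, ψ⟩ := p
  simp only [pairE_apply, encE_apply, fanoutFn_apply, Function.comp_apply, fstF_boolPair, sndF_boolPair, hsize,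
    hcode, unE_eq_ones, ones, List.replicate_add, List.replicate_succ]

/-- Conjunction on codes. -/
theorem codeFP_conj : CodeFP (pairE encE encE) encE fun p => PropForm.conj p.1 p.2 :=
  codeFP_binop [true, true, false] PropForm.conj (fun _ _ => rfl) (fun _ _ => rfl)

/-- Disjunction on codes. -/
theorem codeFP_disj : CodeFP (pairE encE encE) encE fun p => PropForm.disj p.1 p.2 :=
  codeFP_binop [true, true, true] PropForm.disj (fun _ _ => rfl) (fun _ _ => rfl)

/-- Negated CNF formulas on codes (the tree's transcoder `negCNFCode`). -/
theorem codeFP_negOfCNF : CodeFP cnfE encE fun Ψ => PropForm.neg (PropForm.ofCNF Ψ) :=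
  ⟨negCNFCode, negCNFCode_mem_FP_holds, fun Ψ => by simp [negCNFCode, encodingCNF.decode_encode]⟩

variable {Φ : List Bool → CNF ℕ} {gen : List Bool → List Bool}

/-- The Cook–Levin family on codes: its generator. -/
theorem codeFP_Phi (hgen : gen ∈ FP) (hgenΦ : ∀ x, gen x = encodingCNF.encode (Φ x)) : CodeFP strE cnfE Φ :=
  ⟨gen, hgen, hgenΦ⟩

/-- The instance string. -/
theorem codeFP_xin : CodeFP (pairE strE (pairE strE bitE)) strE fun p => xin p.1 p.2.1 p.2.2 :=
  ⟨id, PolyTimeComputable.id _, fun _ => rfl⟩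

/-- Tagging a literal. -/
theorem codeFP_tagLit : CodeFP (pairE strE litE) litE fun p => CookLevin.renLit (tagVar p.1) p.2 := by
  obtain ⟨H, hH, hHs⟩ := (natAdd.comp (((snd strE litE).fst').pair (const (pairE strE litE) 1)) :
    CodeFP (pairE strE litE) natE fun p => p.2.1 + 1)
  have h1 : CodeFP (pairE strE litE) natE fun p => tagVar p.1 p.2.1 :=
    ⟨fun z => fstF z ++ H z, append_mem_FP fstF_mem_FP hH, fun p => by
      show fstF (pairE strE litE p) ++ H (pairE strE litE p) = natE (tagVar p.1 p.2.1)
      rw [hHs]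
      dsimp only
      rw [pairE_apply, fstF_boolPair]
      exact (encodeNat_tagVar p.1 p.2.1).symm⟩
  exact h1.pair (snd strE litE).snd'

/-- Tagging all literals of a CNF, on codes. -/
theorem codeFP_relab : CodeFP (pairE strE cnfE) cnfE fun p => p.2.map fun c => c.map (CookLevin.renLit (tagVar p.1)) := by
  rw [cnfE_eq]
  have hcl : CodeFP (pairE strE (listE litE)) (listE litE) fun p => p.2.map (CookLevin.renLit (tagVar p.1)) :=
    ((listOfRaw litE).comp ((map codeFP_tagLit).comp ((fst _ _).pair ((rawOfList litE).comp (snd _ _))))).congr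
      fun _ => rfl
  exact ((listOfRaw (listE litE)).comp ((map hcl).comp ((fst _ _).pair ((rawOfList (listE litE)).comp (snd _ _))))).congr
    fun _ => rfl

/-- **Blocks on codes.** -/
theorem codeFP_block (hgen : gen ∈ FP) (hgenΦ : ∀ x, gen x = encodingCNF.encode (Φ x)) :
    CodeFP (pairE (pairE strE strE) (pairE strE bitE)) encE fun q => block Φ q.1.1 q.1.2 q.2.1 q.2.2 := by
  have hx : CodeFP (pairE (pairE strE strE) (pairE strE bitE)) cnfE fun q => Φ (xin q.1.1 q.2.1 q.2.2) :=
    (codeFP_Phi hgen hgenΦ).comp (codeFP_xin.comp ((fst _ _).fst'.pair (snd _ _)))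
  refine ((codeFP_negOfCNF.comp (codeFP_relab.comp ((fst _ _).snd'.pair hx))).congr fun q => ?_)
  simp only [block, CookLevin.mapVars_ofCNF]

/-! #### The disjunct: a fold over the images -/

/-- The fold step of a disjunct: consume one bit of the vector, conjoin one block. -/
def djStep (Φ : List Bool → CNF ℕ) (s : List Bool × List Bool) (w : List Bool) (st : List Bool × PropForm ℕ) :
    List Bool × PropForm ℕ :=
  (st.1.drop 1, PropForm.conj st.2 (block Φ s.1 s.2 w (st.1.headD false)))

/-- The fold computes `conjAcc`. -/
theorem foldl_djStep (s : List Bool × List Bool) : ∀ (ws : List (List Bool)) (v' : List Bool) (φ : PropForm ℕ),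
    ws.foldl (fun st w => djStep Φ s w st) (v', φ) = (v'.drop ws.length, conjAcc (block Φ s.1 s.2) ws v' φ)
  | [], v', φ => by simp [conjAcc]
  | w :: ws, v', φ => by
    rw [List.foldl_cons, show djStep Φ s w (v', φ) = (v'.drop 1, PropForm.conj φ (block Φ s.1 s.2 w (v'.headD false)))
      from rfl, foldl_djStep s ws, conjAcc, List.drop_drop, List.length_cons, Nat.add_comm]

/-- Growth of one conjunction on codes. -/
theorem length_encE_conj (φ ψ : PropForm ℕ) :
    (encE (PropForm.conj φ ψ)).length = (encE φ).length + (encE ψ).length + 3 := by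
  simp only [length_encE, PropForm.size, PropForm.code, List.length_cons, List.length_append]
  omega

/-- Size of the accumulated conjunction on codes: the seed plus, per block, its code and `3`. -/
theorem length_encE_conjAcc_le (blk : List Bool → Bool → PropForm ℕ) (P : ℕ) :
    ∀ (ws : List (List Bool)) (v : List Bool) (φ : PropForm ℕ), (∀ w ∈ ws, ∀ b, (encE (blk w b)).length ≤ P) →
      (encE (conjAcc blk ws v φ)).length ≤ (encE φ).length + ws.length * (P + 3)
  | [], _, _, _ => by simp [conjAcc]
  | w :: ws, v, φ, hP => by
    rw [conjAcc]
    refine (length_encE_conjAcc_le blk P ws _ _ fun w' hw' b => hP w' (by simp [hw']) b).trans ?_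
    rw [length_encE_conj, List.length_cons, Nat.succ_mul]
    have := hP w (by simp) (v.headD false)
    omega

/-- **Disjuncts on codes.** -/
theorem codeFP_disjunct (hgen : gen ∈ FP) (hgenΦ : ∀ x, gen x = encodingCNF.encode (Φ x)) :
    CodeFP (pairE (pairE strE (rawE strE)) strE) encE fun p => disjunct Φ p.1.1 p.1.2 p.2 := by
  -- context `s = (N, v)`, items `w`, state `(v', φ)`
  let σE : List Bool × List Bool → List Bool := pairE strE strE
  let βE : List Bool × PropForm ℕ → List Bool := pairE strE encE
  obtain ⟨Bf, hBf, hBfs⟩ := codeFP_block hgen hgenΦ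
  obtain ⟨P, hP⟩ := exists_poly_length_le_of_mem_FP hBf
  have hstep : CodeFP (pairE σE (pairE strE βE)) βE fun t => djStep Φ t.1 t.2.1 t.2.2 :=
    (codeFP_drop_one.comp (snd _ _).snd'.fst').pair (codeFP_conj.comp ((snd _ _).snd'.snd'.pair
      ((codeFP_block hgen hgenΦ).comp ((fst _ _).pair ((snd _ _).fst'.pair (codeFP_headD.comp (snd _ _).snd'.fst'))))))
  have hinit : CodeFP σE βE fun s => (s.2, PropForm.const true) := (snd _ _).pair (const σE _)
  have h := foldl (step := fun s w st => djStep Φ s w st) (init := fun s => (s.2, PropForm.const true)) hstep hinit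
    (2 * X + 9 + X * (P.comp (X + 3) + 3)) (fun s l₁ l₂ => by
      rw [foldl_djStep]
      set W := pairE σE (rawE strE) (s, l₁ ++ l₂) with hW
      have hσ : (σE s).length = 2 * s.1.length + 2 + s.2.length := by
        simp only [σE, pairE_apply, length_boolPair, strE, id]
      have hWlen : W.length = 2 * (σE s).length + 2 + (rawE strE (l₁ ++ l₂)).length := by
        rw [hW, pairE_apply, length_boolPair]
      have hblkle : ∀ w ∈ l₁, ∀ b : Bool, (encE (block Φ s.1 s.2 w b)).length ≤ P.eval (W.length + 3) := by
        intro w hw b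
        have h1 : (encE (block Φ s.1 s.2 w b)).length ≤
            P.eval (pairE (pairE strE strE) (pairE strE bitE) ((s.1, s.2), (w, b))).length := by
          rw [← hBfs ((s.1, s.2), (w, b))]; exact hP _
        refine h1.trans (TM2Iter.eval_mono P ?_)
        have hw' : 2 * w.length + 2 ≤ (rawE strE (l₁ ++ l₂)).length :=
          length_item_le_length_rawE strE (List.mem_append_left l₂ hw)
        simp only [pairE_apply, length_boolPair, bitE, List.length_singleton, strE, id]
        omega
      have hacc := length_encE_conjAcc_le (block Φ s.1 s.2) (P.eval (W.length + 3)) l₁ s.2 (PropForm.const true) hblkle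
      have hv : (List.drop l₁.length s.2).length ≤ W.length := by
        rw [List.length_drop]; omega
      have hl₁ : l₁.length ≤ W.length :=
        (List.Sublist.length_le (List.sublist_append_left l₁ l₂)).trans
          ((length_le_length_rawE strE _).trans (by omega))
      have h7 : (encE (PropForm.const true : PropForm ℕ)).length = 7 := by
        simp [length_encE, PropForm.size, PropForm.code]
      rw [h7] at hacc
      have hmul : l₁.length * (P.eval (W.length + 3) + 3) ≤ W.length * (P.eval (W.length + 3) + 3) :=
        Nat.mul_le_mul_right _ hl₁
      simp only [βE, pairE_apply, length_boolPair, eval_add, eval_mul, eval_X, eval_ofNat, eval_comp, strE, id]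
      omega)
  exact (h.snd'.comp (((fst _ _).fst'.pair (snd _ _)).pair (fst _ _).snd')).congr fun p => by
    simp only [foldl_djStep, disjunct]

end Code

end StubBridge

/-- **Disjuncts are polynomial time on codes** (explicit-binder form, registered sub-goal
`stubBridge_codeFP_disjunct` of stmt-PneNP-10709; chain `stub_bridge` 3/6). -/
theorem stubBridge_codeFP_disjunct (Φ : List Bool → CNF ℕ) (gen : List Bool → List Bool) (hgen : gen ∈ FP)
    (hgenΦ : ∀ x, gen x = encodingCNF.encode (Φ x)) :
    CodeFP (CodeFP.pairE (CodeFP.pairE CodeFP.strE (CodeFP.rawE CodeFP.strE)) CodeFP.strE)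
      StubBridge.encE fun p => StubBridge.disjunct Φ p.1.1 p.1.2 p.2 :=
  StubBridge.codeFP_disjunct hgen hgenΦ

end Summit.PneNP.PneNP.Theorems.LatticeMagicTarget
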